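import Summits.AtomisticToContinuum.Crystallization.Theorems.OverbindingBudgetAffineFarSmoothSplit

/-!
# OverbindingBudget — Hägg-coded Barlow stackings are `1`-separated at the centre; second-shell gap; first shell wins; the identity chart is admissible modulo summability
# (decomp-a2c lens-4, generation 46; S support toward the owed items «AdmissibleInhabitant» (probe P5 of the Z split) and Zr `CoreRegistration`)

Imports ONLY the Z split file (`…Theorems.OverbindingBudgetAffineFarSmoothSplit`: `Chart`, `ChartAdmissible`) and works with the LITERATURE's stackings
`barlowStacking 1 (√(2/3)) s` / `barlowPos` / `IsHaggSeq` / `haggLabel` (`Literature/…/BarlowStacking.lean`, whose docstring leaves «every point has exactly twelve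
points at distance `a` when `h = a√(2/3)`» unformalised — the first-shell facts below are that content at the centre; its `le_dist_of_mem_barlowStacking` gives
only `min 1 √(2/3)`).  PROVED, 0 sorry:
* `haggLabel_one`, `haggLabel_neg_one`, `abs_haggLabel_le` — `ℓ(1) = s 0`, `ℓ(−1) = −s(−1)`, `|ℓ(L)| ≤ |L|` for a Hägg sequence;
* `threeNormSq`, `three_mul_norm_sq_barlowPos` — the INTEGER `3‖barlowPos 1 √(2/3) s L i j‖² = 3(i² + ij + j²) + 3ℓ(i + j) + ℓ² + 2L²`;
* `threeNormSq_eq_three_or_six_le` — for `(L,i,j) ≠ 0` it is `3` or `≥ 6` (three integer quadratic-form facts + `ℓ(±1) = ±1`);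
* `one_le_norm_of_mem_barlowStacking`, `exists_mem_barlowStacking_norm_eq_one`, `norm_eq_one_or_sqrt_two_le_of_mem_barlowStacking` — nearest distance
  `1` at the centre, attained, SECOND-SHELL GAP (`‖p‖ = 1` or `≥ √2`);
* `norm_map_first_shell_le` — FIRST SHELL WINS: for `B` within `m ≤ 1/6` of a linear isometry the minimum of `‖B ·‖` over the reference structure is attained on
  its first shell (this makes the `nn`-clauses of `ChartAdmissible (1/25)` a FINITE check, for Zr and the inhabitant);
* `chartAdmissible_id_of_summable` — for `θ ≥ 0` the chart `⟨s, id, 1, 1⟩` of any Hägg sequence is ADMISSIBLE as soon as its site-energy series is summable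
  (discharged in the sequel `…OverbindingBudgetAffineBarlowSum`; hcp = `alternatingHagg`, `isHaggSeq_alternating`).
-/

namespace Summit.AtomisticToContinuum.Crystallization.Theorems.OverbindingBudgetAffineFarSmoothSplit

open scoped BigOperators Classical
open Literature.MathematicalPhysics.StatisticalMechanics

local notation "E3" => EuclideanSpace ℝ (Fin 3)

/-- `a² + ab + b² ≥ 1` on `ℤ² ∖ {0}`. [this file] -/
theorem int_qf_one_le (a b : ℤ) (h : a ≠ 0 ∨ b ≠ 0) : 1 ≤ a * a + a * b + b * b := by
  rcases eq_or_ne b 0 with rfl | hb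
  · have ha : a ≠ 0 := by tauto
    have : 1 ≤ a * a := by
      rcases Int.ne_iff_lt_or_gt.mp ha with h1 | h1 <;> nlinarith
    simpa using this
  · have hb2 : 1 ≤ b * b := by
      rcases Int.ne_iff_lt_or_gt.mp hb with h1 | h1 <;> nlinarith
    have h4 : 3 ≤ 4 * (a * a + a * b + b * b) := by nlinarith [sq_nonneg (2 * a + b)]
    omega

/-- `a² + ab + b² + a + b ≥ 0` on `ℤ²` (layer label `ℓ = 1`). [this file] -/
private theorem int_qf_shift_one (a b : ℤ) : 0 ≤ a * a + a * b + b * b + a + b := by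
  rcases eq_or_ne b 0 with rfl | hb
  · rcases le_or_gt 0 a with h1 | h1
    · nlinarith
    · have : a ≤ -1 := by omega
      nlinarith
  · have hb' : 0 ≤ 3 * b * b + 2 * b - 1 := by
      rcases Int.ne_iff_lt_or_gt.mp hb with h1 | h1
      · have : b ≤ -1 := by omega
        nlinarith
      · have : 1 ≤ b := by omega
        nlinarith
    nlinarith [sq_nonneg (2 * a + b + 1)]

/-- `a² + ab + b² − a − b ≥ 0` on `ℤ²` (layer label `ℓ = −1`; the point reflection of the previous fact). [this file] -/
private theorem int_qf_shift_neg_one (a b : ℤ) : 0 ≤ a * a + a * b + b * b - a - b := by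
  nlinarith [int_qf_shift_one (-a) (-b)]

/-- `ℓ(1) = s 0`. [this file] -/
private theorem haggLabel_one (s : ℤ → ℤ) : haggLabel s 1 = s 0 := by
  simpa using haggLabel_succ s 0

/-- `ℓ(−1) = −s (−1)`. [this file] -/
private theorem haggLabel_neg_one (s : ℤ → ℤ) : haggLabel s (-1) = -s (-1) := by
  have h := haggLabel_succ s (-1)
  simp at h
  linarith

/-- `|ℓ(L)| ≤ |L|`: the layer label of a Hägg sequence walks by unit steps. [this file] -/
private theorem abs_haggLabel_le {s : ℤ → ℤ} (hs : IsHaggSeq s) (L : ℤ) : |haggLabel s L| ≤ |L| := by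
  have hw : ∀ (m : ℤ) (n : ℕ), |haggWindow s m n| ≤ n := by
    intro m n
    unfold haggWindow
    refine (Finset.abs_sum_le_sum_abs _ _).trans ?_
    have : ∀ i ∈ Finset.range n, |s (m + i)| = 1 := by
      intro i _
      rcases hs (m + i) with h | h <;> simp [h]
    rw [Finset.sum_congr rfl this]
    simp
  rcases le_or_gt 0 L with hL | hL
  · lift L to ℕ using hL
    rw [haggLabel_natCast, Nat.abs_cast]
    exact hw 0 L
  · obtain ⟨n, rfl⟩ : ∃ n : ℕ, L = -(n : ℤ) := ⟨(-L).toNat, by omega⟩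
    rw [haggLabel_neg_natCast, abs_neg, abs_neg, Nat.abs_cast]
    exact hw _ n

/-- The INTEGER `3‖p‖²` of the structure point `p = barlowPos 1 √(2/3) s L i j`: `3(i² + ij + j²) + 3ℓ(i + j) + ℓ² + 2L²`, `ℓ = haggLabel s L`. -/
def threeNormSq (s : ℤ → ℤ) (L i j : ℤ) : ℤ :=
  3 * (i * i + i * j + j * j) + 3 * haggLabel s L * (i + j) + haggLabel s L * haggLabel s L + 2 * L * L

/-- `3‖barlowPos 1 √(2/3) s L i j‖² = threeNormSq s L i j` (coordinates `(i + j/2 + ℓ/2, (√3/2)(j + ℓ/3), L√(2/3))`, `barlowPos_apply_*`). [this file] -/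
theorem three_mul_norm_sq_barlowPos (s : ℤ → ℤ) (L i j : ℤ) :
    3 * ‖barlowPos 1 (Real.sqrt (2 / 3)) s L i j‖ ^ 2 = (threeNormSq s L i j : ℝ) := by
  have h3 : Real.sqrt 3 ^ 2 = 3 := Real.sq_sqrt (by norm_num)
  have h23 : Real.sqrt (2 / 3) ^ 2 = 2 / 3 := Real.sq_sqrt (by norm_num)
  rw [EuclideanSpace.norm_eq, Real.sq_sqrt (Finset.sum_nonneg fun i _ => by positivity), Fin.sum_univ_three]
  rw [barlowPos_apply_zero, barlowPos_apply_one, barlowPos_apply_two]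
  simp only [Real.norm_eq_abs, sq_abs, one_mul, threeNormSq]
  push_cast
  linear_combination (3 / 4 * ((j : ℝ) + (haggLabel s L : ℝ) / 3) ^ 2) * h3 + (3 * (L : ℝ) ^ 2) * h23

/-- The centre: `barlowPos 1 √(2/3) s 0 0 0 = 0` (`ℓ(0) = 0`). [this file] -/
theorem barlowPos_zero_zero_zero (s : ℤ → ℤ) : barlowPos 1 (Real.sqrt (2 / 3)) s 0 0 0 = 0 := by
  ext k; fin_cases k <;> simp

/-- **The squared norms of a Hägg-coded Barlow stacking**: for `(L, i, j) ≠ 0` the integer `3‖p‖²` is `3` or `≥ 6` (centre layer: `3(i² + ij + j²)`; layers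
`±1`: `ℓ = ±1`, `3(i² + ij + j² ± (i + j)) + 3`; layers `|L| ≥ 2`: `≥ 2L² ≥ 8`). [this file] -/
theorem threeNormSq_eq_three_or_six_le {s : ℤ → ℤ} (hs : IsHaggSeq s) {L i j : ℤ} (h : ¬ (L = 0 ∧ i = 0 ∧ j = 0)) :
    threeNormSq s L i j = 3 ∨ 6 ≤ threeNormSq s L i j := by
  unfold threeNormSq
  rcases (by omega : L = 0 ∨ (L = 1 ∨ L = -1) ∨ (L ≤ -2 ∨ 2 ≤ L)) with rfl | hL | hL
  · -- centre layer
    have hij : i ≠ 0 ∨ j ≠ 0 := by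
      rcases eq_or_ne i 0 with rfl | hi
      · rcases eq_or_ne j 0 with rfl | hj
        · exact (h ⟨rfl, rfl, rfl⟩).elim
        · exact Or.inr hj
      · exact Or.inl hi
    have hq := int_qf_one_le i j hij
    simp only [haggLabel_zero]
    omega
  · -- adjacent layers: `ℓ = ±1`
    have h1 := int_qf_shift_one i j
    have h2 := int_qf_shift_neg_one i j
    rcases hL with rfl | rfl
    · have hℓ : haggLabel s 1 = 1 ∨ haggLabel s 1 = -1 := by rw [haggLabel_one]; exact hs 0
      rcases hℓ with hℓ | hℓ <;> rw [hℓ] <;> omega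
    · have hℓ : haggLabel s (-1) = 1 ∨ haggLabel s (-1) = -1 := by
        rw [haggLabel_neg_one]; rcases hs (-1) with h1 | h1 <;> simp [h1]
      rcases hℓ with hℓ | hℓ <;> rw [hℓ] <;> omega
  · -- far layers
    right
    have hX : 0 ≤ 3 * (i * i + i * j + j * j) + 3 * haggLabel s L * (i + j) + haggLabel s L * haggLabel s L := by
      nlinarith [sq_nonneg (2 * i + j + haggLabel s L), sq_nonneg (3 * j + haggLabel s L)]
    have hL2 : 4 ≤ L * L := by rcases hL with hL | hL <;> nlinarith
    nlinarith [hX, hL2]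

/-- A structure point with vanishing indices is the centre; contrapositive form used below. [this file] -/
theorem indices_ne_zero_of_barlowPos_ne_zero {s : ℤ → ℤ} {L i j : ℤ} (h : barlowPos 1 (Real.sqrt (2 / 3)) s L i j ≠ 0) :
    ¬ (L = 0 ∧ i = 0 ∧ j = 0) := by
  rintro ⟨rfl, rfl, rfl⟩
  exact h (barlowPos_zero_zero_zero s)

/-- **Barlow stackings are `1`-separated at the centre**: every nonzero point of `barlowStacking 1 √(2/3) s` (`s` a Hägg sequence) has norm `≥ 1`
(the Literature's `le_dist_of_mem_barlowStacking` gives only `min 1 √(2/3)`; the label structure `ℓ(±1) = ±1` supplies the rest). [this file] -/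
theorem one_le_norm_of_mem_barlowStacking {s : ℤ → ℤ} (hs : IsHaggSeq s) {p : E3} (hp : p ∈ barlowStacking 1 (Real.sqrt (2 / 3)) s)
    (hp0 : p ≠ 0) : 1 ≤ ‖p‖ := by
  obtain ⟨L, i, j, rfl⟩ := hp
  have hM := threeNormSq_eq_three_or_six_le hs (indices_ne_zero_of_barlowPos_ne_zero hp0)
  have h3 : (3 : ℝ) ≤ (threeNormSq s L i j : ℝ) := by
    rcases hM with hM | hM
    · rw [hM]; norm_num
    · exact_mod_cast (by omega : (3 : ℤ) ≤ threeNormSq s L i j)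
  rw [← three_mul_norm_sq_barlowPos] at h3
  nlinarith [norm_nonneg (barlowPos 1 (Real.sqrt (2 / 3)) s L i j)]

/-- The norm `1` is attained on every Barlow stacking (the point `u = barlowPos 1 √(2/3) s 0 1 0 = (1, 0, 0)` of the centre layer). [this file] -/
theorem exists_mem_barlowStacking_norm_eq_one (s : ℤ → ℤ) :
    ∃ p ∈ barlowStacking 1 (Real.sqrt (2 / 3)) s, p ≠ 0 ∧ ‖p‖ = 1 := by
  refine ⟨barlowPos 1 (Real.sqrt (2 / 3)) s 0 1 0, barlowPos_mem 0 1 0, ?_, ?_⟩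
  · intro h
    have := congrArg (fun q : E3 => q 0) h
    simp at this
  · have hsq := three_mul_norm_sq_barlowPos s 0 1 0
    have hM : (threeNormSq s 0 1 0 : ℝ) = 3 := by simp [threeNormSq]
    rw [hM] at hsq
    nlinarith [norm_nonneg (barlowPos 1 (Real.sqrt (2 / 3)) s 0 1 0)]

/-- **Second-shell gap**: a nonzero point of a Hägg-coded Barlow stacking has norm exactly `1` or at least `√2` (`3‖p‖² ∈ {3} ∪ [6, ∞)`). [this file] -/
theorem norm_eq_one_or_sqrt_two_le_of_mem_barlowStacking {s : ℤ → ℤ} (hs : IsHaggSeq s) {p : E3}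
    (hp : p ∈ barlowStacking 1 (Real.sqrt (2 / 3)) s) (hp0 : p ≠ 0) : ‖p‖ = 1 ∨ Real.sqrt 2 ≤ ‖p‖ := by
  obtain ⟨L, i, j, rfl⟩ := hp
  have hM := threeNormSq_eq_three_or_six_le hs (indices_ne_zero_of_barlowPos_ne_zero hp0)
  have hsq := three_mul_norm_sq_barlowPos s L i j
  have hn := norm_nonneg (barlowPos 1 (Real.sqrt (2 / 3)) s L i j)
  rcases hM with hM | hM
  · left
    have : (threeNormSq s L i j : ℝ) = 3 := by exact_mod_cast hM
    rw [this] at hsq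
    nlinarith
  · right
    have h6 : (6 : ℝ) ≤ (threeNormSq s L i j : ℝ) := by exact_mod_cast hM
    rw [← hsq] at h6
    have h2 : 2 ≤ ‖barlowPos 1 (Real.sqrt (2 / 3)) s L i j‖ ^ 2 := by linarith
    calc Real.sqrt 2 ≤ Real.sqrt (‖barlowPos 1 (Real.sqrt (2 / 3)) s L i j‖ ^ 2) := Real.sqrt_le_sqrt h2
      _ = _ := Real.sqrt_sq hn

/-- **First shell wins**: if `B` is within `m ≤ 1/6` of a linear isometry (`‖Bv − Qv‖ ≤ m‖v‖`), then every unit vector `p₁` (in particular every first-shell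
structure point) has `‖B p₁‖ ≤ ‖B p‖` for every nonzero structure point `p` off the first shell — so the minimum of `‖B ·‖` over the (infinite) reference structure
is the minimum over its first shell (`(1 − m)√2 ≥ 1 + m`).  Admissible charts have `m = 3θ = 3/25 ≤ 1/6`. [this file] -/
theorem norm_map_first_shell_le {s : ℤ → ℤ} (hs : IsHaggSeq s) {B : E3 →ₗ[ℝ] E3} {m : ℝ} (hm : m ≤ 1 / 6)
    (hB : ∃ Q : E3 →ₗᵢ[ℝ] E3, ∀ v, ‖B v - Q v‖ ≤ m * ‖v‖) {p₁ p : E3} (h₁ : ‖p₁‖ = 1)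
    (hp : p ∈ barlowStacking 1 (Real.sqrt (2 / 3)) s) (hp0 : p ≠ 0) (hne : ‖p‖ ≠ 1) : ‖B p₁‖ ≤ ‖B p‖ := by
  obtain ⟨Q, hQ⟩ := hB
  have hs2 : Real.sqrt 2 ≤ ‖p‖ := (norm_eq_one_or_sqrt_two_le_of_mem_barlowStacking hs hp hp0).resolve_left hne
  have h2 : Real.sqrt 2 ^ 2 = 2 := Real.sq_sqrt (by norm_num)
  have hs0 : (0 : ℝ) ≤ Real.sqrt 2 := Real.sqrt_nonneg 2
  have hs14 : (7 : ℝ) / 5 ≤ Real.sqrt 2 := by nlinarith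
  -- upper bound at p₁, lower bound at p
  have hu : ‖B p₁‖ ≤ 1 + m := by
    calc ‖B p₁‖ = ‖Q p₁ + (B p₁ - Q p₁)‖ := by rw [add_sub_cancel]
      _ ≤ ‖Q p₁‖ + ‖B p₁ - Q p₁‖ := norm_add_le _ _
      _ ≤ 1 + m := by
          have h' := hQ p₁
          rw [h₁, mul_one] at h'
          rw [Q.norm_map, h₁]; linarith
  have hl : (1 - m) * ‖p‖ ≤ ‖B p‖ := by
    have := norm_sub_norm_le (Q p) (Q p - B p)
    rw [sub_sub_cancel, Q.norm_map] at this
    have h' : ‖Q p - B p‖ ≤ m * ‖p‖ := by rw [norm_sub_rev]; exact hQ p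
    nlinarith
  have hm0 : 0 ≤ m := by
    have := hQ p₁; have h0 : (0 : ℝ) ≤ ‖B p₁ - Q p₁‖ := norm_nonneg _
    rw [h₁] at this; linarith
  nlinarith [norm_nonneg p]

/-- **The identity chart of a Hägg sequence is admissible modulo summability**: for `θ ≥ 0`, `⟨s, id, 1, 1⟩` satisfies every clause of
`ChartAdmissible θ` except the summability of its site-energy series, which is taken as the hypothesis (discharged in `…BarlowSum`). [this file] -/
theorem chartAdmissible_id_of_summable {θ : ℝ} (hθ : 0 ≤ θ) {s : ℤ → ℤ} (hs : IsHaggSeq s)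
    (hsum : Summable fun p : ↥(barlowStacking 1 (Real.sqrt (2 / 3)) s) =>
      lennardJones (1 * ‖(LinearMap.id : E3 →ₗ[ℝ] E3) (p : E3)‖)) :
    ChartAdmissible θ ⟨s, LinearMap.id, 1, 1⟩ := by
  refine ⟨hs, one_pos, one_pos, ⟨LinearIsometry.id, fun v => ?_⟩, fun p hp hp0 => ?_, ?_, hsum⟩
  · simp only [LinearMap.id_coe, id_eq, LinearIsometry.coe_id, sub_self, norm_zero]
    positivity
  · simpa using one_le_norm_of_mem_barlowStacking hs hp hp0
  · obtain ⟨p, hp, hp0, hp1⟩ := exists_mem_barlowStacking_norm_eq_one s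
    exact ⟨p, hp, hp0, by simpa using hp1.symm⟩

end Summit.AtomisticToContinuum.Crystallization.Theorems.OverbindingBudgetAffineFarSmoothSplit
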